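import Summits.ABC.ABC.Theses.DefiniteXi
import Summits.ABC.ABC.Theorems.DefiniteXiFreyModularityStubAbsIrrNegThree
import Summits.ABC.ABC.Theorems.DefiniteXiFreyModularityStubFreyCaseBThreeReducible
import Summits.ABC.ABC.Theorems.DefiniteXiFreyModularityIsModular
import Summits.ABC.ABC.Theorems.DefiniteXiEisensteinQuarantineFreyEigenLinePrime
import Literature.NumberTheory.Automorphic.CDTTheorem712TwoLiftsProofs
import Literature.NumberTheory.EllipticCurves.ThreeDivisionFieldSwanProofs
import Literature.NumberTheory.Sieve.PrimesInAPTwoPowerModuli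
import HarnessLib

/-!
# STUB_IDEAS_stub_freyModularity_2 — stub-ideation k2 (RESHAPE) — `stub_freyModularity` of line `forced-pair-dlog`, crux stmt-ABC-15023

Elaboration sanity file for the helper-lemma signatures of `STUB-IDEAS-stub_freyModularity-2.md`.
Every `sorry` is a proposed helper / reshaped stub; nothing here is registered.
-/

set_option linter.dupNamespace false
set_option linter.unusedVariables false

noncomputable section

namespace Summit.ABC.ABC.Cruxes.EisensteinQuarantine.StubIdeasFreyModularityK2

open Literature.NumberTheory.EllipticCurves Literature.NumberTheory.EllipticCurves.ModularForms
open Literature.NumberTheory.Automorphic Literature.NumberTheory.Automorphic.BCDT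
open Literature.NumberTheory.GaloisRepresentations
open WeierstrassCurve Polynomial

/-- The forced Legendre–Frey curve `E_ℓ := E_(−ℓ, ℓ−1)` : `y² = x (x + ℓ) (x + ℓ − 1)`, i.e. the Legendre
curve `Y² = X (X − 1) (X − ℓ)` after `X = x + ℓ` (triple `1 + (ℓ − 1) = ℓ`). -/
abbrev freyLegendre (ℓ : ℕ) : WeierstrassCurve ℚ := freyCurve (-(ℓ : ℤ)) ((ℓ - 1 : ℕ) : ℤ)

/-! ## The reshaped stub 2b′ (what the composition actually consumes) -/

/-- **2b′ `LegendreModularity`** — `FreyModularity` restricted to the forced family. -/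
def LegendreModularity : Prop :=
  ∀ ℓ : ℕ, ℓ.Prime → 32 ∣ ℓ - 1 →
    ∀ (N : ℕ) [NeZero N], (freyLegendre ℓ).conductorNorm ℤ = N →
      Nonempty (ModularParametrizationData (freyLegendre ℓ) N)

/-- The registered stub trivially gives the reshaped one (so the reshape only WEAKENS stub 2b). -/
theorem legendreModularity_of_freyModularity
    (h : Summit.ABC.ABC.Theses.DefiniteXi.FreyModularity) : LegendreModularity := by
  sorry

/-- **Glue 2′** — the eigen-line on the forced family from rank one + 2b′ (proof = p132391 verbatim,
pointwise). This is the `hR` that `forcedPairDepthLaw_of_occurrence` actually uses. -/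
theorem freyEigenLineForced_of_items
    (h₁ : Literature.NumberTheory.EllipticCurves.takahashi2001_brandtEigenLattice_rank_one)
    (h₂ : LegendreModularity) :
    ∀ ℓ : ℕ, ℓ.Prime → 32 ∣ ℓ - 1 →
      ∀ (N : ℕ) [NeZero N], (freyLegendre ℓ).conductorNorm ℤ = N →
      ∀ (S : Brandt.XiSetup (N / ℓ) ℓ) [Fintype (Brandt.ClassSet S.O)],
        ∃ φ : Brandt.ClassSet S.O → ℤ, φ ≠ 0 ∧
          Brandt.eigenLattice (N / ℓ * ℓ) (Brandt.matrix S.O)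
            (fun n => (freyLegendre ℓ).LFunction n) = ℤ ∙ φ := by
  sorry

/-! ## Plan A — case A on the whole family via the 3-division polynomial (no supply change) -/

/-- **A1 (core arithmetic, Legendre coordinate).** `Ψ₃` of `Y² = X(X−1)(X−λ)` is
`3X⁴ − 4(1+λ)X³ + 6λX² − λ² = 4X³(X−1)³ − (λ − 3X² + 2X³)²`; for an INTEGER `λ ∉ {0, 1}` it has no
rational root: a root `X = u/v` has `v ∣ 3`, and the identity forces `X(X−1)` to be a rational square;
`v = 1`: `u(u−1) = w²` ⇒ `u ∈ {0,1}` ⇒ `λ ∈ {0,1}`; `v = 3`, `3 ∤ u`: `u(u−3) = w²` ⇒ `u ∈ {4, −1}` ⇒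
`81 Ψ₃ = 3λ(32 − 27λ)` resp. `−3(27λ+5)(λ−1)` ≠ 0. -/
theorem psi3Legendre_ne_zero (la : ℤ) (h0 : la ≠ 0) (h1 : la ≠ 1) (X : ℚ) :
    3 * X ^ 4 - 4 * (1 + (la : ℚ)) * X ^ 3 + 6 * (la : ℚ) * X ^ 2 - (la : ℚ) ^ 2 ≠ 0 := by
  sorry

/-- **A2.** On the tree's model: `Ψ₃(E_ℓ)(x) = Ψ₃^{Leg}(x + ℓ)` (`a₁ = a₃ = 0`, `a₂ = 2ℓ − 1`,
`a₄ = ℓ(ℓ−1)`, `a₆ = 0`; `simp [Ψ₃, b₂, b₄, b₆, b₈, freyCurve]; ring`) has no rational root for `ℓ ≥ 2`. -/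
theorem eval_psi3_freyLegendre_ne_zero (ℓ : ℕ) (hℓ : 2 ≤ ℓ) (x : ℚ) :
    (freyLegendre ℓ).Ψ₃.eval x ≠ 0 := by
  sorry

/-- **A3 (descent).** If `Ψ₃` has no rational root then `E[3]` has no `Γ_ℚ`-stable line: a stable
`H ∉ {⊥, ⊤}` of `E[3] ≅ (ℤ/3)²` (`natCard_geomTorsion`) is `{0, T, −T}`, so `σ • T = ±T`, `x(T)` is
`Γ_ℚ`-fixed hence rational (`exists_eq_some_algebraMap_of_forall_smul_eq` /
`InfiniteGalois.fixedField_fixingSubgroup ⊥`), and `Ψ₃(x(T)) = 0`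
(`eval_divisionPolynomial_three_eq_zero_of_eq_some`, `map_Ψ₃`). General in `W`. -/
theorem hasIrreducibleModPGaloisRep_three_of_forall_eval_psi3_ne_zero (W : WeierstrassCurve ℚ)
    [W.IsElliptic] (h : ∀ x : ℚ, W.Ψ₃.eval x ≠ 0) : W.HasIrreducibleModPGaloisRep 3 := by
  sorry

/-- **A4 (case A on the forced family).** Contrapositive of the landed
`exists_stableLine_three_freyCurve_of_caseB` (`A = −ℓ ≡ −1 (mod 4)`, `2 ∣ B = ℓ − 1`) against A2+A3. -/
theorem exists_isAbsIrreducibleOverSqrt_negThree_freyLegendre (ℓ : ℕ) (hℓ : ℓ.Prime)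
    (h32 : 32 ∣ ℓ - 1) :
    ∃ ρ : ModPGaloisRep ℚ (ZMod 3) 2,
      (freyLegendre ℓ).IsTorsionGaloisRep 3 ρ ∧ ρ.IsAbsIrreducibleOverSqrt (-3) := by
  sorry

/-- **A5 (conditional discharge of 2b′ on the trust base `{CDT_theorem_7_2_1}`).** `27 ∤ N` by
`not_nine_dvd_conductorNorm_freyCurve`; datum ⟺ newform by
`nonempty_modularParametrizationData_iff_isModularAt`. -/
theorem legendreModularity_of_CDT_theorem_7_2_1 (h721 : CDT_theorem_7_2_1) : LegendreModularity := by
  sorry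

/-! ## Plan B — case A for free (landed R3) by steering the prime supply into `ℓ ≡ 2 (mod 3)` -/

/-- **B1 (Gallagher off one exceptional modulus, GENERAL coprime class; the tree's
`exists_goodModulus_not_dvd_two_pow` is class `1` only), with the exceptional modulus dividing no
`3·2^s` in range (primitive quadratic conductors `3·2^i` have `i ∈ {0,2,3}`: moduli `3,12,24`, then
`exists_eta_LFunction_ne_zero`).** -/
theorem exists_goodModulus_class (a₀ : ℕ) :
    ∃ δ : ℝ, 0 < δ ∧ ∃ N₁ : ℕ, ∀ N : ℕ, N₁ ≤ N → ∃ b : ℕ, 2 ≤ b ∧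
      (∀ s : ℕ, ((3 * 2 ^ s : ℕ) : ℝ) ≤ (N : ℝ) ^ δ → ¬ b ∣ 3 * 2 ^ s) ∧
      ∀ d : ℕ, 1 ≤ d → (d : ℝ) ≤ (N : ℝ) ^ δ → ¬ b ∣ d → ∀ a : ℕ, a.Coprime d →
        (1 / 2 : ℝ) * N / (Nat.totient d * Real.log N) ≤
          (((Finset.Iic N).filter (fun p => p.Prime ∧ p ≡ a [MOD d])).card : ℝ) := by
  sorry

/-- **B2 (two-prime 2-power supply in the class `ℓ ≡ 2 (mod 3)`)** — as
`PrimesInAPGallagher.exists_primes_two_pow_mul_dvd_sub_one` with moduli `3·2^s·q_i` and the CRT class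
`(1 mod 2^s q_i, 2 mod 3)`. -/
theorem exists_primes_two_pow_mul_dvd_sub_one_mod_three :
    ∃ A s₁ : ℕ, ∀ s : ℕ, s₁ ≤ s →
      ∃ q ℓ : ℕ, q.Prime ∧ ℓ.Prime ∧ 2 ^ s ∣ q - 1 ∧ 2 ^ s * q ∣ ℓ - 1 ∧ ℓ % 3 = 2 ∧
        ℓ ≤ 2 ^ (A * s) := by
  sorry

/-- **B3 (2b′ in the steered regime, on `{CDT_theorem_7_2_1}`, ZERO new arithmetic):**
`3 ∤ (−ℓ)(ℓ−1)(−1) = ℓ(ℓ−1)` iff `ℓ % 3 = 2`, then the landed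
`isModular_freyCurve_of_CDT_theorem_7_2_1_of_not_three_dvd` (R3: good supersingular reduction at `3`). -/
theorem legendreModularity_mod_three_of_CDT_theorem_7_2_1 (h721 : CDT_theorem_7_2_1) :
    ∀ ℓ : ℕ, ℓ.Prime → 32 ∣ ℓ - 1 → ℓ % 3 = 2 →
      ∀ (N : ℕ) [NeZero N], (freyLegendre ℓ).conductorNorm ℤ = N →
        Nonempty (ModularParametrizationData (freyLegendre ℓ) N) := by
  sorry

/-! ## Plan C — strengthen the hypotheses, shrink the theorem: only the SEMISTABLE 3-adic lifting -/

/-- **`LiftThreeSemistable`** — Wiles 1995 Thm. 0.2 at `p = 3` + Taylor–Wiles 1995 (ordinary or flat),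
for semistable `E/ℚ` only: the 1995 lifting statement, strictly weaker than the tree's `lift₃`
(hypothesis `hlift` of `CDT_theorem_7_2_1_of_langlands_tunnell_of_lift_of_three_facts`, which allows
`27 ∤ N`). Proposed NEW named fact (cite item), not in the tree. -/
def LiftThreeSemistable : Prop :=
  ∀ (W : WeierstrassCurve ℚ) [W.IsElliptic] (ρ : ModPGaloisRep ℚ (ZMod 3) 2),
    W.IsTorsionGaloisRep 3 ρ → W.IsSemistable ℤ → ρ.IsAbsIrreducibleOverSqrt (-3) → ρ.IsModular →
      W.IsModularGaloisRepTate 3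

/-- **C1.** 2b′ on the trust base {Langlands–Tunnell, `LiftThreeSemistable`, Eichler–Shimura, Faltings,
Carayol}: `E_ℓ` is semistable (`isSemistable_freyCurve_of_sixteen_dvd`), case A (A4 or `ℓ % 3 = 2` + R3),
mod-3 modularity `modThree_of_langlands_tunnell`, (3) ⇒ (2) `three_imp_two_at_three_of_three_facts`. -/
theorem legendreModularity_of_liftThreeSemistable
    (hLT : ∀ σ : FramedArtinRep ℚ 2, langlands_tunnell σ)
    (hES : eichlerShimuraConstruction)
    (hF : WeierstrassCurve.isIsogenous_iff_frobeniusTrace_eq)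
    (hC : ∀ (N : ℕ) [NeZero N], IsNewformOf.level_eq_conductorNorm (N := N))
    (hlift : LiftThreeSemistable) : LegendreModularity := by
  sorry

/-! ## Sanity (sorry-free): the Ψ₃ identities used by Plan A -/

/-- coefficient sanity: Ψ₃ of the forced Legendre–Frey curve, Frey coordinate -/
example (ℓ : ℕ) (hℓ : 1 ≤ ℓ) (x : ℚ) :
    (freyCurve (-(ℓ : ℤ)) ((ℓ - 1 : ℕ) : ℤ)).Ψ₃.eval x =
      3 * x ^ 4 + 4 * (2 * (ℓ : ℚ) - 1) * x ^ 3 + 6 * (ℓ : ℚ) * ((ℓ : ℚ) - 1) * x ^ 2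
        - (ℓ : ℚ) ^ 2 * ((ℓ : ℚ) - 1) ^ 2 := by
  simp only [freyCurve, Ψ₃, b₂, b₄, b₆, b₈, eval_add, eval_mul, eval_pow, eval_C, eval_X, eval_ofNat,
    Int.cast_neg, Int.cast_natCast, Nat.cast_sub hℓ, Nat.cast_one, Int.cast_sub, Int.cast_one]
  ring

/-- and it is the Legendre Ψ₃ `3X⁴ − 4(1+λ)X³ + 6λX² − λ²` at `X = x + λ`, `λ = ℓ`, which equals
`4X³(X−1)³ − (λ − 3X² + 2X³)²` -/
example (la X : ℚ) :
    3 * X ^ 4 - 4 * (1 + la) * X ^ 3 + 6 * la * X ^ 2 - la ^ 2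
      = 4 * X ^ 3 * (X - 1) ^ 3 - (la - 3 * X ^ 2 + 2 * X ^ 3) ^ 2 := by ring

example (la x : ℚ) :
    3 * x ^ 4 + 4 * (2 * la - 1) * x ^ 3 + 6 * la * (la - 1) * x ^ 2 - la ^ 2 * (la - 1) ^ 2
      = 3 * (x + la) ^ 4 - 4 * (1 + la) * (x + la) ^ 3 + 6 * la * (x + la) ^ 2 - la ^ 2 := by ring

/-- the two `v = 3` evaluations -/
example (la : ℚ) : 81 * (3 * (4/3 : ℚ) ^ 4 - 4 * (1 + la) * (4/3) ^ 3 + 6 * la * (4/3) ^ 2 - la ^ 2)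
    = 3 * la * (32 - 27 * la) := by ring
example (la : ℚ) : 81 * (3 * (-1/3 : ℚ) ^ 4 - 4 * (1 + la) * (-1/3) ^ 3 + 6 * la * (-1/3) ^ 2 - la ^ 2)
    = -3 * (27 * la + 5) * (la - 1) := by ring
end Summit.ABC.ABC.Cruxes.EisensteinQuarantine.StubIdeasFreyModularityK2

end
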